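import Summits.NavierStokesRegularity.NavierStokesRegularity.Theorems.ExtremiserTransienceWeakClassDivFree
import Literature.Analysis.FluidPDE.MildSolution
import Literature.Analysis.FluidPDE.NSBoundedMildSmoothing
import Literature.Analysis.FluidPDE.BoundedMildSmoothRemainder
import Literature.Analysis.FluidPDE.KNSSProp41MildHolds
import HarnessLib

/-!
# Route `ExtremiserTransience`, LINE g5-α repair (seat ns-idea-5 g5): Type-I decay of ALL spatial derivatives of weak-class fields

`--supports stmt-NavierStokesRegularity-27823` (`PlateauSliceRigidity`; by p639422 `plateauSliceRigidity_of_subcubicBudget` it is the subcubic local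
energy budget of the weak one-slice class).  Route-independent module (no `Theses` import).  For a member `(W, K)` of the weak one-slice class
(joint continuity on `(−∞,0) × ℝ³`, Oseen identity between all negative times, `√(−t)‖W t x‖ ≤ K`) and every order `k`, there is `K_k` with
`(−σ)^{(k+1)/2} ‖∇ᵏ W(σ, x)‖ ≤ K_k` for all `σ < 0`, `x` — KNSS 2009 Prop. 4.1 (4.6) (`KNSS2009_prop41_mild_holds k`: `(t−s)^{k/2}‖∇ᵏV(t)‖ ≤ C N` on
windows with `N²(t−s) < ε`) applied to the clamped time-translate on the window `[3σ, σ/2]` (bound `N = K√2/√(−σ)`, sub-window of length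
`ε′(−σ)/(2K²+1)`), exactly as for `k = 1` in `weakClass_gradTypeI_of_divFree` (p637014); weak divergence-freeness of the slices is the landed
`weakClass_isWeaklyDivFree`.  USE (recipe step 2 of the 27823 budget, line card §RECIPE): `k = 1, 2` bound the pressure source
`|pressureSource (W σ)| ≲ (K K₂ + K₁²)(−σ)^{−2}` on windows, the hypothesis `hG` of `pressure_eq_pressurePotentialMod_add_const_of_oseenMild` and of
`exists_abs_pressurePotentialMod_sub_le`.  HONEST FRAMING: regularity bookkeeping for hypothetical blow-up limits; nothing about Navier–Stokes regularity
or blow-up is proved here and no summit is proved by a line. [cite: KochNadirashviliSereginSverak2009, Prop. 4.1 (4.6) (arXiv:0709.3599 §4 p. 8)]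
-/

namespace Summit.NavierStokesRegularity.NavierStokesRegularity.Theorems.ExtremiserTransience
set_option linter.dupNamespace false

open Set Function MeasureTheory Filter Topology
open scoped RealInnerProductSpace ContDiff
open Literature.Analysis Literature.Analysis.FluidPDE Literature.Analysis.UnboundedOperators

/-- **Type-I decay of the `k`-th spatial derivative of a weak-class field**: `(−σ)^{(k+1)/2}‖iteratedFDeriv ℝ k (W σ) x‖ ≤ K_k`.
[cite: KochNadirashviliSereginSverak2009, Prop. 4.1 (4.6)] -/
theorem weakClass_iteratedFDerivTypeI (W : ℝ → EuclideanSpace ℝ (Fin 3) → EuclideanSpace ℝ (Fin 3)) (K : ℝ)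
    (hcont : ContinuousOn (Function.uncurry W) (Set.Iio (0 : ℝ) ×ˢ Set.univ))
    (hmild : ∀ s t : ℝ, s < t → t < 0 → ∀ x, W t x =
      Literature.Analysis.FluidPDE.heatFlow (W s) (t - s) x - Literature.Analysis.FluidPDE.oseenDuhamel 1 s W W t x)
    (hdec : ∀ t : ℝ, t < 0 → ∀ x, Real.sqrt (-t) * ‖W t x‖ ≤ K) (k : ℕ) :
    ∃ Kk : ℝ, 0 ≤ Kk ∧ ∀ σ < 0, ∀ x, (-σ) ^ (((k : ℝ) + 1) / 2) * ‖iteratedFDeriv ℝ k (W σ) x‖ ≤ Kk := by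
  have hdiv := weakClass_isWeaklyDivFree W K hcont hmild hdec
  obtain ⟨ε, hε, C, hC0, hP⟩ := KNSS2009_prop41_mild_holds k
  have hK : 0 ≤ K := by
    have h := hdec (-1) (by norm_num) 0
    have h1 : Real.sqrt (-(-1 : ℝ)) = 1 := by norm_num
    rw [h1, one_mul] at h
    exact (norm_nonneg _).trans h
  -- the sub-window fraction `ε' = min (1/2) (ε/2)` and the scale factor `M = (2K²+1)/ε'`
  set ε' : ℝ := min (1 / 2) (ε / 2) with hε'
  have hε'0 : 0 < ε' := lt_min (by norm_num) (half_pos hε)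
  have hε'h : ε' ≤ 1 / 2 := min_le_left _ _
  have hε'ε : ε' ≤ ε / 2 := min_le_right _ _
  have hKd : 0 < 2 * K ^ 2 + 1 := by positivity
  set M : ℝ := (2 * K ^ 2 + 1) / ε' with hM
  have hM0 : 0 < M := div_pos hKd hε'0
  refine ⟨M ^ ((k : ℝ) / 2) * (C * (K * Real.sqrt 2)), by positivity, fun σ hσ x => ?_⟩
  -- pointwise bound of the slices: `‖W τ y‖ ≤ K/√(−τ)`
  have hbd : ∀ τ < 0, ∀ y, ‖W τ y‖ ≤ K / Real.sqrt (-τ) := by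
    intro τ hτ y
    rw [le_div_iff₀ (Real.sqrt_pos.2 (by linarith)), mul_comm]
    exact hdec τ hτ y
  -- the translated window: `u τ = W (τ + a)`, `a = 3σ`, `S = −5σ/2`, so `[0, S] ↔ [3σ, σ/2]` and `σ ↔ τ⋆ = −2σ`
  set a : ℝ := 3 * σ with ha
  set S : ℝ := -(5 / 2) * σ with hS
  have hSpos : 0 < S := by rw [hS]; linarith
  set N : ℝ := K * Real.sqrt 2 / Real.sqrt (-σ) with hN
  have hsσ : 0 < Real.sqrt (-σ) := Real.sqrt_pos.2 (by linarith)
  have hN0 : 0 ≤ N := by rw [hN]; positivity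
  set u : ℝ → EuclideanSpace ℝ (Fin 3) → EuclideanSpace ℝ (Fin 3) := fun τ => W (τ + a) with hu
  have hneg : ∀ τ ∈ Icc 0 S, τ + a < 0 := by
    intro τ hτ; rw [ha]; have := hτ.2; rw [hS] at this; linarith
  have hle : ∀ τ ∈ Icc 0 S, -σ / 2 ≤ -(τ + a) := by
    intro τ hτ; rw [ha]; have := hτ.2; rw [hS] at this; linarith
  have hcontu : ContinuousOn (uncurry u) (Icc 0 S ×ˢ univ) := by
    have hmap : Continuous fun p : ℝ × EuclideanSpace ℝ (Fin 3) => (p.1 + a, p.2) := by fun_prop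
    have hinto : MapsTo (fun p : ℝ × EuclideanSpace ℝ (Fin 3) => (p.1 + a, p.2)) (Icc 0 S ×ˢ univ) (Iio 0 ×ˢ univ) :=
      fun p hp => ⟨hneg p.1 hp.1, mem_univ _⟩
    exact (hcont.comp hmap.continuousOn hinto).congr fun p _ => rfl
  have hKu : ∀ τ ∈ Icc 0 S, ∀ x, ‖u τ x‖ ≤ N := by
    intro τ hτ x
    have h1 := hbd (τ + a) (hneg τ hτ) x
    refine h1.trans ?_
    have hs2 : 0 < Real.sqrt (-σ / 2) := Real.sqrt_pos.2 (by linarith)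
    have h2 : K / Real.sqrt (-(τ + a)) ≤ K / Real.sqrt (-σ / 2) :=
      div_le_div_of_nonneg_left hK hs2 (Real.sqrt_le_sqrt (hle τ hτ))
    refine h2.trans (le_of_eq ?_)
    rw [hN]
    have hsq : Real.sqrt (-σ / 2) * Real.sqrt 2 = Real.sqrt (-σ) := by
      rw [← Real.sqrt_mul (by linarith : (0:ℝ) ≤ -σ / 2)]; congr 1; ring
    rw [div_eq_div_iff hs2.ne' hsσ.ne', ← hsq]
    ring
  have hdivu : ∀ τ ∈ Icc 0 S, IsWeaklyDivFree (u τ) := fun τ hτ => hdiv (τ + a) (hneg τ hτ)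
  have hmildu : ∀ s t : ℝ, 0 ≤ s → s < t → t ≤ S → ∀ x,
      u t x = heatExtension (u s) (t - s) x - oseenDuhamel 1 s u u t x := by
    intro s t hs hst htS x
    have ht0 : t + a < 0 := hneg t ⟨hs.trans hst.le, htS⟩
    have h := hmild (s + a) (t + a) (by linarith) ht0 x
    have hts : t + a - (s + a) = t - s := by ring
    rw [hts, heatFlow_of_pos (W (s + a)) (sub_pos.2 hst)] at h
    rw [show u t x = W (t + a) x from rfl, h, oseenDuhamel_translate 1 s a W W t x]
  -- KNSS: the clamped translate is drift-mild with zero drift; Prop. 4.1 (4.6) of order `k` on the sub-window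
  have hV := isKNSSDriftMild_clamp_of_oseenForward hSpos hcontu hKu hdivu hmildu
  obtain ⟨-, hwin⟩ := hP hV
  set τs : ℝ := -2 * σ with hτs
  have hτs_mem : τs ∈ Ioo 0 S := by rw [hτs, hS]; constructor <;> linarith
  set d : ℝ := -σ / M with hd
  have hdpos : 0 < d := by rw [hd]; exact div_pos (by linarith) hM0
  have hdM : d * M = -σ := by rw [hd]; field_simp
  have hdle : d ≤ -σ / 2 := by
    -- `M ≥ 2` since `2K²+1 ≥ 1` and `ε' ≤ 1/2`
    have hM2 : 2 ≤ M := by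
      rw [hM, le_div_iff₀ hε'0]; nlinarith [sq_nonneg K]
    rw [hd, div_le_div_iff_of_pos_left (by linarith) hM0 (by norm_num)]
    exact hM2
  have hs0 : 0 < τs - d := by rw [hτs]; linarith
  have hs_mem : τs - d ∈ Ioo 0 S := ⟨hs0, by linarith [hτs_mem.2]⟩
  have ht_mem : τs ∈ Ioo (τs - d) S := ⟨by linarith, hτs_mem.2⟩
  have hNd : N ^ 2 * (τs - (τs - d)) < ε := by
    have h1 : τs - (τs - d) = d := by ring
    rw [h1, hN, div_pow, mul_pow, Real.sq_sqrt (by norm_num : (0:ℝ) ≤ 2), Real.sq_sqrt (by linarith : (0:ℝ) ≤ -σ), hd,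
      hM]
    -- `K²·2/(−σ) · (−σ)/((2K²+1)/ε') = 2K² ε'/(2K²+1) ≤ ε' ≤ ε/2 < ε`
    have hσ0 : (0:ℝ) < -σ := by linarith
    have hσne : σ ≠ 0 := hσ.ne
    have e : K ^ 2 * 2 / -σ * (-σ / ((2 * K ^ 2 + 1) / ε')) = ε' * (2 * K ^ 2 / (2 * K ^ 2 + 1)) := by
      field_simp
    rw [e]
    have hfrac : 2 * K ^ 2 / (2 * K ^ 2 + 1) ≤ 1 := by
      rw [div_le_one hKd]; linarith
    calc ε' * (2 * K ^ 2 / (2 * K ^ 2 + 1)) ≤ ε' * 1 := mul_le_mul_of_nonneg_left hfrac hε'0.le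
      _ < ε := by linarith
  have hder := (hwin (τs - d) hs_mem τs ht_mem hNd).1 x
  -- identify the clamped slice at `τ⋆` with `W σ`
  have hclamp : max 0 (min τs S) = τs := by
    rw [min_eq_left hτs_mem.2.le, max_eq_right hτs_mem.1.le]
  have hστ : τs + a = σ := by rw [hτs, ha]; ring
  have hslice : (fun y => u (max 0 (min τs S)) y) = W σ := by
    funext y; rw [hclamp, show u τs y = W (τs + a) y from rfl, hστ]
  rw [hslice, show τs - (τs - d) = d by ring] at hder
  -- `d^{k/2} ‖∇ᵏW(σ)x‖ ≤ C N` ⇒ `(−σ)^{(k+1)/2} ‖∇ᵏW(σ)x‖ = M^{k/2} √(−σ) · d^{k/2} ‖∇ᵏW(σ)x‖ ≤ M^{k/2} √(−σ) C N = M^{k/2} C K √2`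
  have hσ0 : (0:ℝ) < -σ := by linarith
  have hsplit : (-σ) ^ (((k : ℝ) + 1) / 2) = M ^ ((k : ℝ) / 2) * Real.sqrt (-σ) * d ^ ((k : ℝ) / 2) := by
    rw [show ((k : ℝ) + 1) / 2 = (k : ℝ) / 2 + 1 / 2 by ring, Real.rpow_add hσ0, ← Real.sqrt_eq_rpow, ← hdM,
      Real.mul_rpow hdpos.le hM0.le, hdM]
    ring
  rw [hsplit]
  calc M ^ ((k : ℝ) / 2) * Real.sqrt (-σ) * d ^ ((k : ℝ) / 2) * ‖iteratedFDeriv ℝ k (W σ) x‖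
      = M ^ ((k : ℝ) / 2) * Real.sqrt (-σ) * (d ^ ((k : ℝ) / 2) * ‖iteratedFDeriv ℝ k (W σ) x‖) := by ring
    _ ≤ M ^ ((k : ℝ) / 2) * Real.sqrt (-σ) * (C * N) := mul_le_mul_of_nonneg_left hder (by positivity)
    _ = M ^ ((k : ℝ) / 2) * (C * (K * Real.sqrt 2)) * (Real.sqrt (-σ) / Real.sqrt (-σ)) := by rw [hN]; ring
    _ = M ^ ((k : ℝ) / 2) * (C * (K * Real.sqrt 2)) := by rw [div_self hsσ.ne', mul_one]

/-- **Hessian Type-I decay** (`k = 2`, the form used for the pressure source): `(−σ)·√(−σ)·‖iteratedFDeriv ℝ 2 (W σ) x‖ ≤ K₂`.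
[cite: KochNadirashviliSereginSverak2009, Prop. 4.1 (4.6)] -/
theorem weakClass_hessTypeI (W : ℝ → EuclideanSpace ℝ (Fin 3) → EuclideanSpace ℝ (Fin 3)) (K : ℝ)
    (hcont : ContinuousOn (Function.uncurry W) (Set.Iio (0 : ℝ) ×ˢ Set.univ))
    (hmild : ∀ s t : ℝ, s < t → t < 0 → ∀ x, W t x =
      Literature.Analysis.FluidPDE.heatFlow (W s) (t - s) x - Literature.Analysis.FluidPDE.oseenDuhamel 1 s W W t x)
    (hdec : ∀ t : ℝ, t < 0 → ∀ x, Real.sqrt (-t) * ‖W t x‖ ≤ K) :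
    ∃ K₂ : ℝ, 0 ≤ K₂ ∧ ∀ σ < 0, ∀ x, (-σ) * Real.sqrt (-σ) * ‖iteratedFDeriv ℝ 2 (W σ) x‖ ≤ K₂ := by
  obtain ⟨K₂, hK₂, h⟩ := weakClass_iteratedFDerivTypeI W K hcont hmild hdec 2
  refine ⟨K₂, hK₂, fun σ hσ x => ?_⟩
  have hσ0 : (0:ℝ) < -σ := by linarith
  have e : (-σ) ^ ((((2 : ℕ) : ℝ) + 1) / 2) = (-σ) * Real.sqrt (-σ) := by
    rw [show (((2 : ℕ) : ℝ) + 1) / 2 = (1 : ℝ) + 1 / 2 by norm_num, Real.rpow_add hσ0, Real.rpow_one, Real.sqrt_eq_rpow]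
  have := h σ hσ x
  rwa [e] at this

end Summit.NavierStokesRegularity.NavierStokesRegularity.Theorems.ExtremiserTransience
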